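import Summits.RiemannHypothesis.RiemannHypothesis.Theorems.PfPersistenceGalerkinDownCone
import Summits.RiemannHypothesis.RiemannHypothesis.Theorems.PfPersistenceCollarBound
import Summits.RiemannHypothesis.RiemannHypothesis.Theorems.PfPersistenceLocalityBarrier
import Summits.RiemannHypothesis.RiemannHypothesis.Theorems.PfPersistenceInWindowMirror
import HarnessLib

/-!
# Edge-layer signs of the one-prime pattern and the exact dial inequality (fake-5 gen 3, RH-free)

Mechanism / rigidity campaign `pub-rhpf` (FAKE SEAT 5, family F5 = prime-sum re-weightings);
**no RH claims** — nothing here mentions `RiemannHypothesis` or window positivity of ζ.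

The hp atom-block data product `certs/f5-topblocks/` tabulates the blocks
`B^{(q)}_{kl} = u_kᵀ Θ(log q) u_l` of the one-prime pattern `primePattern q win` in ζ's soft
eigenbasis and observes the SIGN LAW: for atoms in the edge layer (`log q` close to `2a`) every
entry is positive (even sector).  This file is the kernel statement behind that law:

* `sum_thetaEven_eq_crossAutocorr` / `dotProduct_primePattern_mulVec`:
  the BILINEAR pattern form is the windowed cross-autocorrelation
  `vᵀ Θ(y) w = ∫_{-L/2}^{L/2-y} θ_v(x) θ_w(x+y) dx` (polarised `sum_thetaEven_eq_autocorr`);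
* `crossAutocorr_nonneg_of_layerNonneg`: if both profiles are `≥ 0` on the EDGE LAYER
  `[y - L/2, L/2]` (no hypothesis in the bulk) then the form at lag `y ≤ L` is `≥ 0` — by evenness
  of Galerkin profiles the integrand only samples the two edge layers;
* `primePattern_form_nonneg_of_layerNonneg`: hence every entry `u_kᵀ Θ(log q) u_l` of the block
  of an atom reaching the window is `≥ 0` as soon as `θ_{u_k}, θ_{u_l} ≥ 0` on the layer
  `[log q - a, a]` (the DATA part of the law is exactly this per-mode layer sign);
* `bottomRayleigh_dial_le` / `bottomRayleigh_dial_le_rayleigh`: the EXACT (variational, not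
  perturbative) dial inequality `ε₁(dial q K w) ≤ (vᵀQ_w v − 2(K−1)w(q)·A_v(log q)) / vᵀv`, so a
  weight INCREASE (`(K-1)·w q ≥ 0`) at a reached atom lowers the even floor below the Rayleigh
  quotient of every layer-nonnegative test vector, in particular of a one-signed bottom vector.
-/

set_option linter.dupNamespace false

noncomputable section

open Real intervalIntegral MeasureTheory Set Matrix

namespace Summit.RiemannHypothesis.RiemannHypothesis.Theorems.PfPersistence

/-! ## 1. The bilinear pattern form is a windowed cross-autocorrelation -/

/-- `v ⬝ᵥ (M w) = Σ_n Σ_m v_n M_{nm} w_m`. [folklore] -/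
theorem dotProduct_mulVec_eq_sum₂ {N : ℕ} (M : Matrix (Fin (N + 1)) (Fin (N + 1)) ℝ)
    (v w : Fin (N + 1) → ℝ) :
    v ⬝ᵥ (M *ᵥ w) = ∑ n, ∑ m, v n * M n m * w m := by
  simp only [dotProduct, Matrix.mulVec, Finset.mul_sum, mul_assoc]

/-- **PROVED** (polarised `sum_thetaEven_eq_autocorr`): the bilinear `θ`-kernel form is the windowed
cross-autocorrelation `Σ_n Σ_m v_n θ_{nm}(y) w_m = ∫_{-L/2}^{L/2-y} θ_v(x) θ_w(x+y) dx`. [folklore] -/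
theorem sum_thetaEven_eq_crossAutocorr {L : ℝ} (hL : 0 < L) {N : ℕ} (v w : Fin (N + 1) → ℝ) (y : ℝ) :
    ∑ n : Fin (N + 1), ∑ m : Fin (N + 1), v n * thetaEven L n m y * w m
      = ∫ x in (-(L / 2))..(L / 2 - y), profile L v x * profile L w (x + y) := by
  have hint : ∀ x, profile L v x * profile L w (x + y)
      = ∑ n : Fin (N + 1), ∑ m : Fin (N + 1), v n * w m * (xiEven L n x * xiEven L m (x + y)) := by
    intro x; unfold profile; rw [Finset.sum_mul_sum]
    exact Finset.sum_congr rfl fun n _ => Finset.sum_congr rfl fun m _ => by ring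
  simp_rw [hint]
  rw [intervalIntegral.integral_finsetSum
    (f := fun (n : Fin (N + 1)) x => ∑ m : Fin (N + 1), v n * w m * (xiEven L n x * xiEven L m (x + y)))
    (fun n _ => Continuous.intervalIntegrable (by fun_prop) _ _)]
  refine Finset.sum_congr rfl fun n _ => ?_
  rw [intervalIntegral.integral_finsetSum
    (f := fun (m : Fin (N + 1)) x => v n * w m * (xiEven L n x * xiEven L m (x + y)))
    (fun m _ => Continuous.intervalIntegrable (by fun_prop) _ _)]
  refine Finset.sum_congr rfl fun m _ => ?_
  rw [intervalIntegral.integral_const_mul, ← thetaEven_eq_integral hL]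
  ring

/-- **PROVED**: the bilinear ONE-PRIME PATTERN FORM is the cross-autocorrelation at lag `log p`:
`v ⬝ᵥ (primePattern p win · w) = ∫ θ_v(x) θ_w(x + log p) dx` — the atom block `B^{(p)}_{kl}` of the
data product is this with `v = u_k`, `w = u_l`. [folklore] -/
theorem dotProduct_primePattern_mulVec {win : Window} (ha : 0 < win.a) (p : ℕ)
    (v w : Fin (win.N + 1) → ℝ) :
    v ⬝ᵥ (primePattern p win *ᵥ w)
      = ∫ x in (-(2 * win.a / 2))..(2 * win.a / 2 - Real.log p),
          profile (2 * win.a) v x * profile (2 * win.a) w (x + Real.log p) := by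
  rw [dotProduct_mulVec_eq_sum₂, ← sum_thetaEven_eq_crossAutocorr (by positivity)]
  rfl

/-! ## 2. Edge-layer nonnegativity is enough -/

/-- **PROVED (edge-layer sign lemma)**: if `θ_v ≥ 0` and `θ_w ≥ 0` on the edge layer `[y - L/2, L/2]`
and `y ≤ L`, then `∫_{-L/2}^{L/2-y} θ_v(x) θ_w(x+y) dx ≥ 0`.  The integration variable ranges over
`[-L/2, L/2 - y]`, so `-x` and `x + y` both lie in the layer; Galerkin profiles are even
(`CollarBound.profile_neg_arg`), hence the integrand is a product of two layer values. [folklore] -/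
theorem crossAutocorr_nonneg_of_layerNonneg {L y : ℝ} (hyL : y ≤ L) {N : ℕ} {v w : Fin (N + 1) → ℝ}
    (hv : ∀ x ∈ Set.Icc (y - L / 2) (L / 2), 0 ≤ profile L v x)
    (hw : ∀ x ∈ Set.Icc (y - L / 2) (L / 2), 0 ≤ profile L w x) :
    0 ≤ ∫ x in (-(L / 2))..(L / 2 - y), profile L v x * profile L w (x + y) := by
  apply intervalIntegral.integral_nonneg (by linarith)
  intro x hx
  have h1 : 0 ≤ profile L v x := by
    rw [← CollarBound.profile_neg_arg]
    exact hv (-x) ⟨by linarith [hx.2], by linarith [hx.1]⟩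
  have h2 : 0 ≤ profile L w (x + y) := hw _ ⟨by linarith [hx.1], by linarith [hx.2]⟩
  exact mul_nonneg h1 h2

/-- **PROVED (entrywise sign law of an atom block, even sector)**: at a window of half-width `a > 0`
reaching the prime power `p` (`log p ≤ 2a`), if the profiles of `v` and `w` are `≥ 0` on the edge
layer `[log p - a, a]`, then `v ⬝ᵥ (primePattern p win · w) ≥ 0`.  With `v = u_k`, `w = u_l` the soft
modes of ζ in the edge-positive gauge this is `B^{(p)}_{kl} ≥ 0` — the hypothesis (no node of
`u_k`, `u_l` inside the layer) is the DATA part of the law. [folklore] -/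
theorem primePattern_form_nonneg_of_layerNonneg {win : Window} (ha : 0 < win.a) {p : ℕ}
    (hp : p ∈ primeRange (2 * win.a)) {v w : Fin (win.N + 1) → ℝ}
    (hv : ∀ x ∈ Set.Icc (Real.log p - 2 * win.a / 2) (2 * win.a / 2), 0 ≤ profile (2 * win.a) v x)
    (hw : ∀ x ∈ Set.Icc (Real.log p - 2 * win.a / 2) (2 * win.a / 2), 0 ≤ profile (2 * win.a) w x) :
    0 ≤ v ⬝ᵥ (primePattern p win *ᵥ w) := by
  rw [dotProduct_primePattern_mulVec ha]
  exact crossAutocorr_nonneg_of_layerNonneg (log_le_of_mem_primeRange (by positivity) hp) hv hw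

/-- PROVED: the quadratic case — `θ_v ≥ 0` on the layer `[log p - a, a]` gives a nonnegative pattern
form (weaker hypothesis than `primePattern_form_nonneg_of_oneSigned`, which asks one sign on the
whole window). [folklore] -/
theorem primePattern_form_nonneg_of_layerNonneg_self {win : Window} (ha : 0 < win.a) {p : ℕ}
    (hp : p ∈ primeRange (2 * win.a)) {v : Fin (win.N + 1) → ℝ}
    (hv : ∀ x ∈ Set.Icc (Real.log p - 2 * win.a / 2) (2 * win.a / 2), 0 ≤ profile (2 * win.a) v x) :
    0 ≤ v ⬝ᵥ (primePattern p win *ᵥ v) :=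
  primePattern_form_nonneg_of_layerNonneg ha hp hv hv

/-! ## 3. The exact dial inequality -/

/-- **PROVED (exact dial inequality, even block)**: at a window reaching `p`, for every weight table
`w`, dial value `K` and test vector `v ≠ 0`,
`ε₁(evenBlock (dial p K w) win) ≤ (vᵀ·evenBlock w win·v − 2(K−1)·w(p)·A_v(log p)) / vᵀv`
with `A_v` the windowed autocorrelation of `θ_v`.  Variational (test the dialled block on `v`,
`evenBlock_dial_eq`), no perturbation theory, every `K`. [folklore] -/
theorem bottomRayleigh_dial_le {win : Window} (ha : 0 < win.a) {p : ℕ}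
    (hp : p ∈ primeRange (2 * win.a)) (K : ℝ) (w : Weights) {v : Fin (win.N + 1) → ℝ} (hv : v ≠ 0) :
    bottomRayleigh (evenBlock (dial p K w) win)
      ≤ (v ⬝ᵥ (evenBlock w win *ᵥ v) - 2 * (K - 1) * w p * autocorr (2 * win.a) v (Real.log p))
          / (v ⬝ᵥ v) := by
  rw [evenBlock_dial_eq hp]
  have h := bottomRayleigh_le_rayleigh (evenBlock w win - (2 * (K - 1) * w p) • primePattern p win) hv
  rw [Matrix.sub_mulVec, Matrix.smul_mulVec, dotProduct_sub, dotProduct_smul, smul_eq_mul,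
    primePattern_form_eq_autocorr ha] at h
  simpa [mul_assoc] using h

/-- **PROVED (weight increase at a reached atom lowers the even floor)**: if `(K − 1)·w(p) ≥ 0`
(weight INCREASED at `p`, or decreased at a negative weight) and the test vector's profile is `≥ 0`
on the edge layer `[log p − a, a]`, then `ε₁(evenBlock (dial p K w) win) ≤ vᵀ·evenBlock w win·v / vᵀv`.
Applied to a one-signed bottom vector `v` of `evenBlock w win` (ζ: the nodeless even ground state,
DATA) the right side is `ε₁(evenBlock w win)`: far dials UP can only lower the even floor. [folklore] -/
theorem bottomRayleigh_dial_le_rayleigh {win : Window} (ha : 0 < win.a) {p : ℕ}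
    (hp : p ∈ primeRange (2 * win.a)) {K : ℝ} {w : Weights} (hKw : 0 ≤ (K - 1) * w p)
    {v : Fin (win.N + 1) → ℝ} (hv : v ≠ 0)
    (hlayer : ∀ x ∈ Set.Icc (Real.log p - 2 * win.a / 2) (2 * win.a / 2), 0 ≤ profile (2 * win.a) v x) :
    bottomRayleigh (evenBlock (dial p K w) win) ≤ v ⬝ᵥ (evenBlock w win *ᵥ v) / (v ⬝ᵥ v) := by
  have h := bottomRayleigh_dial_le ha hp K w hv
  have hA : 0 ≤ autocorr (2 * win.a) v (Real.log p) :=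
    crossAutocorr_nonneg_of_layerNonneg (log_le_of_mem_primeRange (by positivity) hp) hlayer hlayer
  have hvv : 0 < v ⬝ᵥ v :=
    lt_of_le_of_ne (CentralMassFloor.dotProduct_self_nonneg v) fun h0 => hv (dotProduct_self_eq_zero.1 h0.symm)
  refine h.trans (div_le_div_of_nonneg_right ?_ hvv.le)
  have : 0 ≤ 2 * (K - 1) * w p * autocorr (2 * win.a) v (Real.log p) := by
    have := mul_nonneg hKw hA
    nlinarith
  linarith

/-- **PROVED (monotone form)**: with `v` a bottom vector of `evenBlock w win` that is nonnegative on
the layer, `ε₁(evenBlock (dial p K w) win) ≤ ε₁(evenBlock w win)` whenever `(K − 1)·w(p) ≥ 0`. [folklore] -/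
theorem bottomRayleigh_dial_le_bottomRayleigh {win : Window} (ha : 0 < win.a) {p : ℕ}
    (hp : p ∈ primeRange (2 * win.a)) {K : ℝ} {w : Weights} (hKw : 0 ≤ (K - 1) * w p)
    {v : Fin (win.N + 1) → ℝ} (hv : v ≠ 0)
    (hbot : v ⬝ᵥ (evenBlock w win *ᵥ v) / (v ⬝ᵥ v) = bottomRayleigh (evenBlock w win))
    (hlayer : ∀ x ∈ Set.Icc (Real.log p - 2 * win.a / 2) (2 * win.a / 2), 0 ≤ profile (2 * win.a) v x) :
    bottomRayleigh (evenBlock (dial p K w) win) ≤ bottomRayleigh (evenBlock w win) := by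
  rw [← hbot]
  exact bottomRayleigh_dial_le_rayleigh ha hp hKw hv hlayer


end Summit.RiemannHypothesis.RiemannHypothesis.Theorems.PfPersistence
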